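import Summits.Parity.GeneralizedHardyLittlewood.Theorems.FordMaynardSieveConst01651SieveConst01651LinePart01
import Summits.Parity.GeneralizedHardyLittlewood.Theorems.FordMaynardSieveConst01651SieveConst01651HwtBound
import HarnessLib

/-!
# Route `FordMaynardSieveConst01651`, target `SieveConst01651` (stmt-Parity-19185): line `sieve_decomposition` re-homed — proofs, part 2 of 12 (file 3 of 13)

File 3 of 13 of the VERBATIM re-homing under `Theorems/` of the registered line skeleton
`Summits/Parity/GeneralizedHardyLittlewood/Cruxes/SieveConst01651/Lines/sieve_decomposition.lean` (v21, sha16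
`ada6d0765119a11e`; author seat `linewriter-parity-smallroutes-1`, g0 v1–v20 / g1 v21): Ford–Maynard, Theorem 7.3 (a) at
`P = (1/2, 0, ν)` with CLOSED support, cut along arXiv:2407.14368 §7.2 / §6.2, composed down to the route target
`Summit.Parity.GeneralizedHardyLittlewood.Theses.FordMaynardSieveConst01651.SieveConst01651`.  Namespace
`Summit.Parity.GeneralizedHardyLittlewood.FordMaynardSieveConst01651SieveDecomposition` (fresh; the `Cruxes` copy keeps its own), files of
≤ 400 lines chained by import; the three registered stubs are replaced by their landed proofs
(`…StubSignClauseFive` p834287, `…StubCertValuePos` p837763, `…TypeIIRegion` p833045), so the skeleton's composition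
`SieveConst01651_of_stubs` (last part) is sorry-free.  Mathematics, statements and comments are the linewriter's; this
re-homing (hand `leafhand-parity-fordmaynardsieveco-2` g4) only moved the definitions (`Eset`, `sliceTest`, `mainG1`, `vk`,
the `Signature.*` statement abbreviations, `Phi`, `innerI`, `jumpSet`, `gval`, `symmExt`, `idxProd`, `gam`) into the first
file, added docstrings where missing, and renamed two unused binders.
Declarations in this part: `sum_smallSquareFactor_le`, `squarefull_patch`, `abs_g_le_uniform`, `abs_Gwt_le_uniform`, `Ico_one_succ`, `abel_identity`, `abel_bound`, `sum_abs_diff_le`.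

References: [FordMaynard2024PrimeSieves] K. Ford, J. Maynard, *On the theory of prime producing sieves*, arXiv:2407.14368,
Theorem 7.3 (a), Proposition 7.19, §6.2, §7.2, §8.2.
-/

noncomputable section

open Finset
open Literature.NumberTheory.Sieve Literature.NumberTheory.Sieve.FordMaynard Literature.Barriers.Parity.FordMaynard
open Summit.Parity.GeneralizedHardyLittlewood.FordMaynardSieveConst01651SieveConst01651
  (hfun Admissible hfun_apply hfun_of_ne pvec roughPart smoothPart Gwt Hwt window IsRough Nset Rset mem_window mem_Nset mem_Rset
   coneCert openSmall stub_hkPieces stub_coneCertClosed_of_residues' coneCert_signClause_five_of_generic)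

namespace Summit.Parity.GeneralizedHardyLittlewood.FordMaynardSieveConst01651SieveDecomposition

/-- `sum_smallSquareFactor_le` — lemma of the line skeleton `sieve_decomposition` (v21, seat `linewriter-parity-smallroutes-1`), re-homed verbatim. [folklore] -/
theorem sum_smallSquareFactor_le {ν x B : ℝ} (_hν : 0 < ν) (hν1 : ν ≤ 1) (hx : 2 ≤ x) (hB : 0 ≤ B)
    {a : ℕ → ℝ} (ha : ∀ n, 0 ≤ a n) (hT : TypeI (fun n => a n - 1) x (1 / 2) B) {T : Finset ℕ}
    (hTw : T ⊆ window x)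
    (hT1 : ∀ n ∈ T, ∃ p : ℕ, p.Prime ∧ p * p ∣ n ∧ (p : ℝ) ≤ x ^ (1 / 4 : ℝ) ∧ (x / 2) ^ ν < (p : ℝ)) :
    ∑ n ∈ T, a n ≤ x / Real.log x ^ B + 2 * x ^ (1 - ν) + Real.sqrt x := by
  classical
  have hx0 : 0 < x := by linarith
  have hx1 : 1 ≤ x := by linarith
  set P₁ : Finset ℕ := (Icc 1 ⌊x ^ (1 / 4 : ℝ)⌋₊).filter (fun p => p.Prime ∧ (x / 2) ^ ν < (p : ℝ))
    with hP₁
  set w : ℕ → ℝ := fun n => a n - 1 with hw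
  have h1 : ∑ n ∈ T, a n ≤ ∑ p ∈ P₁, ∑ n ∈ (window x).filter (fun n => p * p ∣ n), a n := by
    have hle : ∀ n ∈ T, a n ≤ ∑ p ∈ P₁.filter (fun p => p * p ∣ n), a n := by
      intro n hn
      obtain ⟨p, hp, hdvd, hp4, hpν⟩ := hT1 n hn
      have hpP : p ∈ P₁.filter (fun p => p * p ∣ n) := by
        rw [mem_filter, hP₁, mem_filter, mem_Icc]
        exact ⟨⟨⟨hp.one_lt.le, Nat.le_floor hp4⟩, hp, hpν⟩, hdvd⟩
      exact single_le_sum (f := fun _ => a n) (fun _ _ => ha n) hpP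
    calc ∑ n ∈ T, a n ≤ ∑ n ∈ T, ∑ p ∈ P₁.filter (fun p => p * p ∣ n), a n := sum_le_sum hle
      _ ≤ ∑ n ∈ window x, ∑ p ∈ P₁.filter (fun p => p * p ∣ n), a n :=
          sum_le_sum_of_subset_of_nonneg hTw fun n _ _ => sum_nonneg fun _ _ => ha n
      _ = ∑ n ∈ window x, ∑ p ∈ P₁, (if p * p ∣ n then a n else 0) := by
          refine sum_congr rfl fun n _ => ?_
          rw [sum_filter]
      _ = ∑ p ∈ P₁, ∑ n ∈ window x, (if p * p ∣ n then a n else 0) := sum_comm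
      _ = ∑ p ∈ P₁, ∑ n ∈ (window x).filter (fun n => p * p ∣ n), a n := by
          refine sum_congr rfl fun p _ => ?_
          rw [sum_filter]
  set I₁ : ℕ → ℕ × ℕ := fun _ => (1, ⌊x⌋₊) with hI₁
  have h2 : ∀ p ∈ P₁, ∑ n ∈ (window x).filter (fun n => p * p ∣ n), a n
      ≤ |innerI w x I₁ (p * p)| + (x / 2 * ((p : ℝ) ^ 2)⁻¹ + 1) := by
    intro p hp
    rw [hP₁, mem_filter] at hp
    obtain ⟨-, hpr, -⟩ := hp
    have hpp0 : p * p ≠ 0 := mul_ne_zero hpr.ne_zero hpr.ne_zero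
    rw [sum_window_filter_dvd a hx0.le hpp0]
    have hK := card_cofactors_le hx0.le (Nat.pos_of_ne_zero hpp0)
    have hak : ∀ k, a (p * p * k) = w (p * p * k) + 1 := fun k => by simp [hw]
    rw [sum_congr rfl (fun k _ => hak k), sum_add_distrib, sum_const, nsmul_eq_mul, mul_one]
    have hin : innerI w x I₁ (p * p)
        = ∑ k ∈ (Icc 1 ⌊x⌋₊).filter
            (fun k : ℕ => x / 2 < ((p * p : ℕ) : ℝ) * (k : ℝ) ∧ ((p * p : ℕ) : ℝ) * (k : ℝ) ≤ x),
            w (p * p * k) := rfl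
    rw [← hin]
    have hcast : x / (2 * ((p * p : ℕ) : ℝ)) = x / 2 * ((p : ℝ) ^ 2)⁻¹ := by
      have hp0 : (p : ℝ) ≠ 0 := by exact_mod_cast hpr.ne_zero
      push_cast
      field_simp
    linarith [le_abs_self (innerI w x I₁ (p * p)), hcast ▸ hK]
  have h3 : ∑ p ∈ P₁, |innerI w x I₁ (p * p)| ≤ x / Real.log x ^ B := by
    have hinj : Set.InjOn (fun p : ℕ => p * p) ↑P₁ := fun a _ b _ h => Nat.mul_self_inj.1 h
    have := sum_image hinj (f := fun m => |innerI w x I₁ m|)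
    rw [← this]
    apply typeI_extract hB hT I₁
    intro m hm
    rw [mem_image] at hm
    obtain ⟨p, hp, rfl⟩ := hm
    rw [hP₁, mem_filter, mem_Icc] at hp
    obtain ⟨⟨_, h2⟩, hpr, -⟩ := hp
    rw [mem_Icc]
    refine ⟨Nat.one_le_iff_ne_zero.2 (mul_ne_zero hpr.ne_zero hpr.ne_zero), Nat.le_floor ?_⟩
    have hp4 : (p : ℝ) ≤ x ^ (1 / 4 : ℝ) := (Nat.cast_le.2 h2).trans (Nat.floor_le (by positivity))
    have h44 : (x ^ (1 / 4 : ℝ)) * (x ^ (1 / 4 : ℝ)) = x ^ (1 / 2 : ℝ) := by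
      rw [← Real.rpow_add hx0]; norm_num
    push_cast
    rw [← h44]
    exact mul_le_mul hp4 hp4 (Nat.cast_nonneg _) (by positivity)
  have h4 : ∑ p ∈ P₁, (x / 2 * ((p : ℝ) ^ 2)⁻¹ + 1) ≤ 2 * x ^ (1 - ν) + Real.sqrt x := by
    rw [sum_add_distrib, ← mul_sum, sum_const, nsmul_eq_mul, mul_one]
    set k₀ : ℕ := ⌊(x / 2) ^ ν⌋₊ with hk₀
    set n₀ : ℕ := ⌊x ^ (1 / 4 : ℝ)⌋₊ + 1 with hn₀
    have hxh : (0 : ℝ) < (x / 2) ^ ν := by positivity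
    have hsubI : P₁ ⊆ Ioo k₀ n₀ := by
      intro p hp
      rw [hP₁, mem_filter, mem_Icc] at hp
      obtain ⟨⟨_, h2⟩, _, hν'⟩ := hp
      rw [mem_Ioo]
      constructor
      · have : (k₀ : ℝ) < p := (Nat.floor_le hxh.le).trans_lt hν'
        exact_mod_cast this
      · omega
    have hinv : ∑ p ∈ P₁, ((p : ℝ) ^ 2)⁻¹ ≤ 2 / (x / 2) ^ ν := by
      calc ∑ p ∈ P₁, ((p : ℝ) ^ 2)⁻¹ ≤ ∑ i ∈ Ioo k₀ n₀, ((i : ℝ) ^ 2)⁻¹ :=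
            sum_le_sum_of_subset_of_nonneg hsubI fun i _ _ => by positivity
        _ ≤ 2 / (k₀ + 1) := sum_Ioo_inv_sq_le k₀ n₀
        _ ≤ 2 / (x / 2) ^ ν := div_le_div_of_nonneg_left zero_le_two hxh (Nat.lt_floor_add_one _).le
    have hhalf : x ^ ν / 2 ≤ (x / 2) ^ ν := by
      rw [Real.div_rpow hx0.le zero_le_two]
      apply div_le_div_of_nonneg_left (by positivity) (by positivity)
      calc (2 : ℝ) ^ ν ≤ 2 ^ (1 : ℝ) := Real.rpow_le_rpow_of_exponent_le one_le_two hν1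
        _ = 2 := Real.rpow_one 2
    have hxν : 0 < x ^ ν := by positivity
    have hmain : x / 2 * ∑ p ∈ P₁, ((p : ℝ) ^ 2)⁻¹ ≤ 2 * x ^ (1 - ν) := by
      calc x / 2 * ∑ p ∈ P₁, ((p : ℝ) ^ 2)⁻¹ ≤ x / 2 * (2 / (x / 2) ^ ν) :=
            mul_le_mul_of_nonneg_left hinv (by positivity)
        _ ≤ x / 2 * (2 / (x ^ ν / 2)) := by
            apply mul_le_mul_of_nonneg_left _ (by positivity)
            exact div_le_div_of_nonneg_left zero_le_two (by positivity) hhalf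
        _ = 2 * x ^ (1 - ν) := by
            rw [Real.rpow_sub hx0, Real.rpow_one]
            field_simp
    have hcardP : (P₁.card : ℝ) ≤ Real.sqrt x := by
      calc (P₁.card : ℝ) ≤ ((Icc 1 ⌊x ^ (1 / 4 : ℝ)⌋₊).card : ℝ) := by
            exact_mod_cast card_le_card (filter_subset _ _)
        _ = (⌊x ^ (1 / 4 : ℝ)⌋₊ : ℝ) := by simp
        _ ≤ x ^ (1 / 4 : ℝ) := Nat.floor_le (by positivity)
        _ ≤ x ^ (1 / 2 : ℝ) := Real.rpow_le_rpow_of_exponent_le hx1 (by norm_num)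
        _ = Real.sqrt x := (Real.sqrt_eq_rpow x).symm
    linarith
  calc ∑ n ∈ T, a n ≤ ∑ p ∈ P₁, ∑ n ∈ (window x).filter (fun n => p * p ∣ n), a n := h1
    _ ≤ ∑ p ∈ P₁, (|innerI w x I₁ (p * p)| + (x / 2 * ((p : ℝ) ^ 2)⁻¹ + 1)) := sum_le_sum h2
    _ = ∑ p ∈ P₁, |innerI w x I₁ (p * p)| + ∑ p ∈ P₁, (x / 2 * ((p : ℝ) ^ 2)⁻¹ + 1) := sum_add_distrib
    _ ≤ x / Real.log x ^ B + 2 * x ^ (1 - ν) + Real.sqrt x := by linarith [h3, h4]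

/-- `squarefull_patch` — lemma of the line skeleton `sieve_decomposition` (v21, seat `linewriter-parity-smallroutes-1`), re-homed verbatim. [folklore] -/
theorem squarefull_patch :
    ∀ ν : ℝ, 0 < ν → ν < 1 / 4 → ∀ x : ℝ, 2 ≤ x → ∀ B : ℝ, 0 < B → ∀ a : ℕ → ℝ, (∀ n, 0 ≤ a n) →
    TypeI (fun n => a n - 1) x (1 / 2) B →
      ∑ n ∈ Eset ν x, a n ≤ 4 * x ^ (1 - ν) + 2 * Real.sqrt x + 2 + 2 * x / Real.log x ^ B := by
  intro ν hν hν4 x hx B hB a ha hT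
  classical
  have hx0 : 0 < x := by linarith
  set kind1 : ℕ → Prop := fun n =>
    ∃ p : ℕ, p.Prime ∧ p * p ∣ n ∧ (p : ℝ) ≤ x ^ (1 / 4 : ℝ) ∧ (x / 2) ^ ν < (p : ℝ) with hkind1
  rw [← sum_filter_add_sum_filter_not (Eset ν x) kind1 a]
  have hT1w : (Eset ν x).filter kind1 ⊆ window x :=
    fun n hn => ((mem_Eset'.1 (mem_filter.1 hn).1).1).1
  have hT2w : (Eset ν x).filter (fun n => ¬ kind1 n) ⊆ window x :=
    fun n hn => ((mem_Eset'.1 (mem_filter.1 hn).1).1).1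
  have hA := sum_smallSquareFactor_le hν (by linarith) hx hB.le ha hT hT1w (fun n hn => (mem_filter.1 hn).2)
  have hB' : ∑ n ∈ (Eset ν x).filter (fun n => ¬ kind1 n), a n ≤ x / Real.log x ^ B + Real.sqrt x := by
    refine sum_sq_primes_le hx hB.le ha hT hT2w fun n hn => ?_
    rw [mem_filter, mem_Eset'] at hn
    obtain ⟨⟨⟨hw, h2, hnp, hr⟩, hexc⟩, hk⟩ := hn
    obtain ⟨⟨-, hle⟩, hgt⟩ := mem_window.1 hw
    have hnx : (n : ℝ) ≤ x := (Nat.cast_le.2 hle).trans (Nat.floor_le hx0.le)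
    rcases hexc with ⟨p, hp, hdvd, hp4⟩ | ⟨p, hp, hnp2⟩
    · exfalso
      refine hk ⟨p, Nat.prime_of_mem_primeFactors hp, by simpa [sq] using hdvd, ?_, ?_⟩
      · exact hp4.trans (Real.rpow_le_rpow (Nat.cast_nonneg n) hnx (by norm_num))
      · exact (Real.rpow_lt_rpow (by positivity) hgt hν).trans (hr p hp)
    · exact ⟨p, Nat.prime_of_mem_primeFactors hp, by rw [hnp2, sq]⟩
  have h0 : 0 ≤ x ^ (1 - ν) := by positivity
  have : 2 * x / Real.log x ^ B = 2 * (x / Real.log x ^ B) := by ring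
  linarith

/-- `abs_g_le_uniform` — lemma of the line skeleton `sieve_decomposition` (v21, seat `linewriter-parity-smallroutes-1`), re-homed verbatim. [folklore] -/
theorem abs_g_le_uniform {ν : ℝ} (hν : 0 < ν) {g : VecFn} (hadm : Admissible ν g) :
    ∃ C : ℝ, 0 ≤ C ∧ ∀ (k : ℕ) (x : Fin k → ℝ), Monotone x → |g k x| ≤ C := by
  obtain ⟨-, hpc, -, hsupp, -⟩ := hadm
  have hC : ∀ k, ∃ C : ℝ, ∀ x : Fin k → ℝ, Monotone x → |g k x| ≤ C := by
    intro k
    obtain ⟨m, P, c, -, hg⟩ := hpc k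
    classical
    refine ⟨∑ j, |c j|, fun x hx => ?_⟩
    rw [hg x hx]
    refine (abs_sum_le_sum_abs _ _).trans (sum_le_sum fun j _ => ?_)
    split_ifs <;> simp
  choose C hC using hC
  set K₀ : ℕ := ⌊1 / ν⌋₊ with hK₀
  refine ⟨∑ k ∈ range (K₀ + 1), |C k|, sum_nonneg fun k _ => abs_nonneg _, fun k x hx => ?_⟩
  by_cases hk : k ≤ K₀
  · exact (hC k x hx).trans ((le_abs_self _).trans
      (single_le_sum (f := fun k => |C k|) (fun k _ => abs_nonneg _) (mem_range.2 (Nat.lt_succ_of_le hk))))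
  · have h0 : g k x = 0 := by
      by_contra h
      rcases hsupp k x h with h1 | ⟨h2, h3⟩
      · exact hk (h1 ▸ Nat.zero_le _)
      · have hkpos : 0 < k := by omega
        have hlt : (k : ℝ) * ν < 1 / 2 := by
          calc (k : ℝ) * ν = ∑ _i : Fin k, ν := by simp
            _ < ∑ i, x i := by
                apply Finset.sum_lt_sum_of_nonempty
                · exact Finset.univ_nonempty_iff.2 ⟨⟨0, hkpos⟩⟩
                · intro i _; exact h2 i
            _ ≤ 1 / 2 := h3
        apply hk
        apply Nat.le_floor
        rw [le_div_iff₀ hν]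
        linarith
    rw [h0, abs_zero]
    exact sum_nonneg fun k _ => abs_nonneg _

/-- `abs_Gwt_le_uniform` — lemma of the line skeleton `sieve_decomposition` (v21, seat `linewriter-parity-smallroutes-1`), re-homed verbatim. [folklore] -/
theorem abs_Gwt_le_uniform {ν : ℝ} (hν : 0 < ν) {g : VecFn} (hadm : Admissible ν g) :
    ∃ C : ℝ, 0 ≤ C ∧ ∀ n d : ℕ, |Gwt g ν n d| ≤ C := by
  obtain ⟨C, hC0, hC⟩ := abs_g_le_uniform hν hadm
  refine ⟨C, hC0, fun n d => ?_⟩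
  unfold Gwt
  split_ifs with h
  · rw [abs_mul]
    calc _ ≤ 1 * C :=
          mul_le_mul (Iwaniec1978.abs_moebius_cast_le _) (hC _ _ (_root_.Summit.Parity.GeneralizedHardyLittlewood.FordMaynardSieveConst01651SieveConst01651.pvec_mono _ _)) (abs_nonneg _) zero_le_one
      _ = C := one_mul C
  · simpa using hC0

/-- `Ico_one_succ` — lemma of the line skeleton `sieve_decomposition` (v21, seat `linewriter-parity-smallroutes-1`), re-homed verbatim. [folklore] -/
theorem Ico_one_succ {N : ℕ} (h : 1 ≤ N) : Ico 1 (N + 1) = insert N (Ico 1 N) := by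
  ext k; simp only [mem_Ico, mem_insert]; omega

/-- `abel_identity` — lemma of the line skeleton `sieve_decomposition` (v21, seat `linewriter-parity-smallroutes-1`), re-homed verbatim. [folklore] -/
theorem abel_identity (w G : ℕ → ℝ) (N : ℕ) :
    ∑ k ∈ Icc 1 N, w k * G k
      = G N * (∑ k ∈ Icc 1 N, w k) - ∑ k ∈ Ico 1 N, (G (k + 1) - G k) * ∑ j ∈ Icc 1 k, w j := by
  induction N with
  | zero => simp
  | succ N ih =>
    rw [show Icc 1 (N + 1) = insert (N + 1) (Icc 1 N) by ext k; simp only [mem_Icc, mem_insert]; omega,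
      sum_insert (by simp), sum_insert (by simp), ih]
    rcases Nat.eq_zero_or_pos N with rfl | hN
    · simp [mul_comm]
    · rw [Ico_one_succ hN, sum_insert (by simp)]
      ring

/-- `abel_bound` — lemma of the line skeleton `sieve_decomposition` (v21, seat `linewriter-parity-smallroutes-1`), re-homed verbatim. [folklore] -/
theorem abel_bound (w G : ℕ → ℝ) (N : ℕ) {M : ℝ} (hM0 : 0 ≤ M)
    (hM : ∀ i ∈ Icc 1 N, |∑ k ∈ Icc 1 i, w k| ≤ M) :
    |∑ k ∈ Icc 1 N, w k * G k| ≤ (|G N| + ∑ k ∈ Ico 1 N, |G (k + 1) - G k|) * M := by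
  rw [abel_identity]
  have hSN : |∑ k ∈ Icc 1 N, w k| ≤ M := by
    rcases Nat.eq_zero_or_pos N with rfl | hN
    · simpa using hM0
    · exact hM N (by rw [mem_Icc]; omega)
  calc |G N * ∑ k ∈ Icc 1 N, w k - ∑ k ∈ Ico 1 N, (G (k + 1) - G k) * ∑ j ∈ Icc 1 k, w j|
      ≤ |G N * ∑ k ∈ Icc 1 N, w k| + |∑ k ∈ Ico 1 N, (G (k + 1) - G k) * ∑ j ∈ Icc 1 k, w j| := abs_sub _ _
    _ ≤ |G N| * M + ∑ k ∈ Ico 1 N, |G (k + 1) - G k| * M := by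
        apply add_le_add
        · rw [abs_mul]; exact mul_le_mul_of_nonneg_left hSN (abs_nonneg _)
        · refine (abs_sum_le_sum_abs _ _).trans (sum_le_sum fun k hk => ?_)
          rw [abs_mul]
          refine mul_le_mul_of_nonneg_left (hM k ?_) (abs_nonneg _)
          rw [mem_Ico] at hk; rw [mem_Icc]; omega
    _ = _ := by rw [← sum_mul]; ring

/-- `sum_abs_diff_le` — lemma of the line skeleton `sieve_decomposition` (v21, seat `linewriter-parity-smallroutes-1`), re-homed verbatim. [folklore] -/
theorem sum_abs_diff_le (G : ℕ → ℝ) (N : ℕ) {C : ℝ} (hC : ∀ k, |G k| ≤ C) :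
    ∑ k ∈ Ico 1 N, |G (k + 1) - G k|
      ≤ 2 * C * (((Ico 1 N).filter (fun k => G (k + 1) ≠ G k)).card : ℝ) := by
  classical
  rw [← sum_filter_add_sum_filter_not (Ico 1 N) (fun k => G (k + 1) ≠ G k)]
  have h2 : ∑ k ∈ (Ico 1 N).filter (fun k => ¬ (G (k + 1) ≠ G k)), |G (k + 1) - G k| = 0 := by
    refine sum_eq_zero fun k hk => ?_
    rw [mem_filter, not_not] at hk
    rw [hk.2, sub_self, abs_zero]
  rw [h2, add_zero]
  calc ∑ k ∈ (Ico 1 N).filter (fun k => G (k + 1) ≠ G k), |G (k + 1) - G k|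
      ≤ ∑ k ∈ (Ico 1 N).filter (fun k => G (k + 1) ≠ G k), 2 * C := by
        refine sum_le_sum fun k _ => ?_
        calc |G (k + 1) - G k| ≤ |G (k + 1)| + |G k| := abs_sub _ _
          _ ≤ C + C := add_le_add (hC _) (hC _)
          _ = 2 * C := by ring
    _ = 2 * C * _ := by rw [sum_const, nsmul_eq_mul]; ring

end Summit.Parity.GeneralizedHardyLittlewood.FordMaynardSieveConst01651SieveDecomposition

end
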